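import Literature.AlgebraicGeometry.Motives.UniversalHyperplaneSectionFamilyGoodLine
import Literature.AlgebraicGeometry.Motives.GoodPencilThroughOpen
import Literature.NumberTheory.Transcendental.AnalytificationSecondCountableProofs
import Literature.AlgebraicGeometry.HodgeTheory.AlgebraicClassesFibreRestriction
import Literature.AlgebraicGeometry.HodgeTheory.HodgeConjectureQbarVoisinProofs
import HarnessLib

/-!
# The family of hyperplane sections of the fibres of a smooth projective family, VII: good fibres and the anchor

Topic `Literature/AlgebraicGeometry/HodgeTheory` (theorems only). For the family
`g = (toX ≫ f, proj) : 𝒴 ⟶ S × (ℙᴺ)^*` of hyperplane sections of the fibres of a smooth projective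
family `f : 𝒳 ⟶ S` of `(n+1)`-folds (`Motives/UniversalHyperplaneSectionFamily…`):

* `isClosedImmersion_fiberι_comp_fst_left`, `isAffineHom_comp_fst_left` — for `𝒳 ↪ ℙᴺ × S` over an
  affine `S`, `e = ε ≫ pr_{ℙᴺ}` is affine and a closed immersion on every fibre;
* `isSmoothProjective_fiberOver_of_mem_goodLocus` — the fibres of `g` over the good locus `G` are smooth
  projective `n`-folds (irreducibility by Ehresmann from a good pencil member);
* `map_fiberι_toX_mem_algebraicClasses_of_slice` — **the anchor**: if `A|_{X_{s₀}}` is algebraic then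
  `toX^* A` is algebraic on every good section `X_{s₀} ∩ H` (flat pull-back to the slice family and the
  tree's fibre-restriction theorem `map_fiberι_mem_algebraicClasses`).

## References

* [VoisinHodgeII2003] C. Voisin, Hodge Theory and Complex Algebraic Geometry II, CUP 2003, §2.1.1 and §3.2.2.
* [Thomas2005Nodes] R. P. Thomas, Nodes and the Hodge conjecture, J. Algebraic Geom. 14 (2005), §5.
-/

noncomputable section

open CategoryTheory CategoryTheory.Limits AlgebraicGeometry TopologicalSpace MonoidalCategory
  CartesianMonoidalCategory
open Literature.AlgebraicGeometry.Motives Literature.AlgebraicGeometry.HodgeTheory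
open Literature.AlgebraicGeometry.Motives.UniversalHyperplaneSection
open Literature.AlgebraicGeometry.Motives.SectionFamily

namespace Literature.AlgebraicGeometry.HodgeTheory.SectionFamily

section ThomasFamily

variable {n N d : ℕ} {𝒳 S : SchemeOver ℂ} (f : 𝒳 ⟶ S) (e : 𝒳 ⟶ projectiveSpace N ℂ)

/-- The fibres of a family embedded in `ℙᴺ × S` over `S` embed in `ℙᴺ`: `X_t ⟶ 𝒳 ⟶ ℙᴺ × S ⟶ ℙᴺ` is a
closed immersion (`X_t` is the base change of `𝒳 ↪ ℙᴺ × S` along `ℙᴺ × {t} ↪ ℙᴺ × S`, and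
`ℙᴺ × {t} ⥲ ℙᴺ`). [folklore] -/
theorem isClosedImmersion_fiberι_comp_fst_left (ε : 𝒳 ⟶ projectiveSpace N ℂ ⊗ S) [IsClosedImmersion ε.left]
    (hε : ε ≫ snd (projectiveSpace N ℂ) S = f) (t : ComplexPoints S) :
    IsClosedImmersion (fiberι f t ≫ ε ≫ fst (projectiveSpace N ℂ) S).left := by
  have F : IsPullback (fiberι f t) (fiberOverToSpec f t) (ε ≫ snd (projectiveSpace N ℂ) S) t := by
    rw [hε]; exact isPullback_fiberι f t
  have A := (isPullback_snd_whiskerLeft t (projectiveSpace N ℂ)).flip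
  have sq := IsPullback.of_bot' F A
  haveI : IsClosedImmersion (A.lift (fiberι f t ≫ ε) (fiberOverToSpec f t) (by rw [Category.assoc, F.w])).left :=
    MorphismProperty.of_isPullback (P := @IsClosedImmersion) (sq.map (Over.forget _)) ‹_›
  have hfac : fiberι f t ≫ ε ≫ fst (projectiveSpace N ℂ) S =
      A.lift (fiberι f t ≫ ε) (fiberOverToSpec f t) (by rw [Category.assoc, F.w]) ≫
        fst (projectiveSpace N ℂ) (specOver ℂ ℂ) := by
    rw [← whiskerLeft_fst (projectiveSpace N ℂ) t]
    conv_rhs => rw [← Category.assoc, IsPullback.lift_fst]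
    rfl
  haveI := isIso_specOver_self_hom (k := ℂ)
  haveI : IsIso (fst (projectiveSpace N ℂ) (specOver ℂ ℂ)).left :=
    inferInstanceAs (IsIso (pullback.fst (projectiveSpace N ℂ).hom (specOver ℂ ℂ).hom))
  rw [hfac, Over.comp_left]
  infer_instance

/-- `ι_t ≫ e` affine-friendly embedding data: `e = ε ≫ pr_{ℙᴺ}` is affine for `S` affine. [folklore] -/
theorem isAffineHom_comp_fst_left (ε : 𝒳 ⟶ projectiveSpace N ℂ ⊗ S) [IsClosedImmersion ε.left] [IsAffine S.left] :
    IsAffineHom (ε ≫ fst (projectiveSpace N ℂ) S).left := by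
  haveI := isAffineHom_fst_left S (projectiveSpace N ℂ)
  rw [Over.comp_left]
  infer_instance

/-- **The fibres of `g` over the good locus are smooth projective `n`-folds.** Smooth of dimension `n`
by definition of `G`, projective (`isProjectiveOver_fiberOver_sectionFamily`), and geometrically
irreducible: through the fibre `X_{t₀}` passes a good pencil whose line meets the generic-smoothness
open (`exists_open_forall_smooth_fiberOver_slice`, `exists_pencil_through_open`, `exists_lineMap`);
its member over `[0 : 1]` is a smooth projective `n`-fold isomorphic to a fibre of `g` over `G`
(`pencil_smooth_and_members_iso`), whose complex points are therefore connected, and connectedness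
spreads to all fibres over the connected `G(ℂ)` by Ehresmann
(`geometricallyIrreducible_fiberOver_of_connectedSpace`). [cite: VoisinHodgeII2003, §2.1.1 and §3.2.2] -/
theorem isSmoothProjective_fiberOver_of_mem_goodLocus (hf : IsSmoothProjectiveFamily f (n + 1))
    [IrreducibleSpace S.left] [SmoothOfRelativeDimension d S.hom] [IsAffine S.left] [IsAffineHom e.left]
    (hN : 2 ≤ N) (hn : 1 ≤ n) (he : ∀ t : ComplexPoints S, IsClosedImmersion (fiberι f t ≫ e).left)
    (t₀ : ComplexPoints S) (G : (S ⊗ dualProjectiveSpace N ℂ).left.Opens)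
    (hGsm : SmoothOfRelativeDimension n ((CartesianMonoidalCategory.lift (toX N e ≫ f) (proj N e)).left ∣_ G))
    (hGiff : ∀ b : ComplexPoints (S ⊗ dualProjectiveSpace N ℂ), b.pt ∈ G ↔
      SmoothOfRelativeDimension n (fiberOver (CartesianMonoidalCategory.lift (toX N e ≫ f) (proj N e)) b).hom)
    (b : ComplexPoints (S ⊗ dualProjectiveSpace N ℂ)) (hb : b.pt ∈ G) :
    IsSmoothProjective n (fiberOver (CartesianMonoidalCategory.lift (toX N e ≫ f) (proj N e)) b) := by
  haveI : Smooth S.hom := SmoothOfRelativeDimension.smooth d _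
  haveI : LocallyOfFiniteType S.hom := inferInstance
  haveI : IsSeparated S.hom := inferInstance
  haveI := hGsm
  haveI := (hGiff b).mp hb
  -- an anchor fibre with connected complex points: a good pencil member of `X_{t₀}`
  obtain ⟨U, hUne, hU⟩ := exists_open_forall_smooth_fiberOver_slice f e t₀ hf (d := d) hN
  haveI := he t₀
  obtain ⟨a, ha₀, hminor, hXta, hconn, haU⟩ := exists_pencil_through_open (hf.isSmoothProjective t₀)
    (fiberι f t₀ ≫ e) hn (by omega) U hUne
  obtain ⟨Λ, hΛ⟩ := exists_lineMap a hminor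
  haveI := hconn
  obtain ⟨-, hmem⟩ := pencil_smooth_and_members_iso f e t₀ Λ hf (d := d) hN a hXta hΛ U hU
  -- the member over `λ₀ = [0 : 1]`, i.e. the section by `[a₀]`
  have h01 : (![0, 1] : Fin (1 + 1) → ℂ) ≠ 0 := fun h => by
    have h1 := congrFun h 1
    simp only [Matrix.cons_val_one, Pi.zero_apply] at h1
    exact one_ne_zero h1
  obtain ⟨hc, hΛ01⟩ := hΛ ![0, 1] h01
  have hc' : (fun i => (![0, 1] : Fin (1 + 1) → ℂ) 1 * a 0 i - (![0, 1] : Fin (1 + 1) → ℂ) 0 * a 1 i) = a 0 := by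
    funext i; simp
  have hl0 : (ProjectiveSpace.pointOfVec ℂ ![0, 1] h01).pt ∈ Λ.left ⁻¹ᵁ U := by
    change Λ.left.base (ProjectiveSpace.pointOfVec ℂ ![0, 1] h01).pt ∈ U
    rw [← AlgPoints.pt_map, hΛ01]
    convert haU using 3
  obtain ⟨hZ, ψ, -⟩ := hmem _ hl0
  set b₁ := AlgPoints.map (Λ ≫ CartesianMonoidalCategory.lift (toSpecOver (dualProjectiveSpace N ℂ) ≫ t₀)
    (𝟙 (dualProjectiveSpace N ℂ))) (ProjectiveSpace.pointOfVec ℂ ![0, 1] h01) with hb₁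
  haveI : ConnectedSpace (ComplexPoints (fiberOver (CartesianMonoidalCategory.lift (toX N e ≫ f) (proj N e)) b₁)) :=
    connectedSpace_complexPoints_of_iso hZ ψ
  have hb₁G : b₁.pt ∈ G := by
    rw [hGiff, hb₁, AlgPoints.map_comp_apply, map_slice]
    exact hU _ hl0
  -- instances for Ehresmann over `G`
  haveI := (isSmoothProjective_projectiveSpace_holds ℂ N).smoothOfRelativeDimension
  haveI : IsSeparated (dualProjectiveSpace N ℂ).hom := inferInstance
  haveI : LocallyOfFiniteType (dualProjectiveSpace N ℂ).hom := inferInstance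
  haveI : QuasiCompact (dualProjectiveSpace N ℂ).hom := inferInstance
  haveI := smoothOfRelativeDimension_tensorObj_hom S (dualProjectiveSpace N ℂ) (d := d) (m := N)
  haveI := isSeparated_tensorObj_hom S (dualProjectiveSpace N ℂ)
  haveI := isSeparated_total_hom f hf
  haveI := locallyOfFiniteType_total_hom f hf
  haveI := compactSpace_total_left f hf
  haveI := isSeparated_universalHyperplaneSection_hom N e
  haveI := locallyOfFiniteType_section_hom e
  haveI := locallyOfFiniteType_tensorObj_hom S (dualProjectiveSpace N ℂ)
  haveI := compactSpace_tensorObj_left S (dualProjectiveSpace N ℂ)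
  haveI := compactSpace_section_left e
  haveI := isProper_sectionFamily_left f e hf
  haveI : SecondCountableTopology (ComplexPoints (universalHyperplaneSection N e)) :=
    ComplexPoints.secondCountableTopology_of_compactSpace_holds _
  haveI : SecondCountableTopology (ComplexPoints (S ⊗ dualProjectiveSpace N ℂ)) :=
    ComplexPoints.secondCountableTopology_of_compactSpace_holds _
  -- `G(ℂ)` is connected: `S × (ℙᴺ)^*` is irreducible
  haveI : IrreducibleSpace (S ⊗ dualProjectiveSpace N ℂ).left := by
    haveI := (isSmoothProjective_projectiveSpace_holds ℂ N).geometricallyIrreducible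
    haveI := (isSmoothProjective_projectiveSpace_holds ℂ N).smoothOfRelativeDimension
    haveI : Smooth (dualProjectiveSpace N ℂ).hom := SmoothOfRelativeDimension.smooth N _
    haveI : UniversallyOpen (dualProjectiveSpace N ℂ).hom := inferInstance
    exact inferInstanceAs (IrreducibleSpace ↥(pullback S.hom (dualProjectiveSpace N ℂ).hom))
  have hGconn : IsPreconnected {b : ComplexPoints (S ⊗ dualProjectiveSpace N ℂ) | b.pt ∈ G} := by
    have h := ComplexPoints.isConnected_setOf_pt_mem_inter_of_isIrreducible (S ⊗ dualProjectiveSpace N ℂ)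
      isClosed_univ (IrreducibleSpace.isIrreducible_univ _) G ⟨b₁.pt, Set.mem_univ _, hb₁G⟩
    have h' : IsConnected {b : ComplexPoints (S ⊗ dualProjectiveSpace N ℂ) | b.pt ∈ G} := by
      simpa only [Set.mem_univ, true_and, SetLike.mem_coe] using h
    exact h'.isPreconnected
  refine ⟨(hGiff b).mp hb, isProjectiveOver_fiberOver_sectionFamily f e b hf, ?_⟩
  exact geometricallyIrreducible_fiberOver_of_connectedSpace (d := n) (m := N + d)
    (CartesianMonoidalCategory.lift (toX N e ≫ f) (proj N e)) G hGconn hb₁G b hb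

/-- A non-empty open of a `ℂ`-scheme locally of finite type has a complex point. [folklore] -/
theorem exists_complexPoint_mem {Y : SchemeOver ℂ} [LocallyOfFiniteType Y.hom] (U : Y.left.Opens)
    (hU : (U : Set Y.left).Nonempty) : ∃ P : ComplexPoints Y, P.pt ∈ U := by
  haveI : JacobsonSpace Y.left := LocallyOfFiniteType.jacobsonSpace Y.hom
  obtain ⟨y, hyU, hyc⟩ := nonempty_inter_closedPoints hU U.isOpen.isLocallyClosed
  obtain ⟨P, rfl⟩ := EsnaultLevineViehweg.exists_algPoints_pt_eq (X := Y) (k := ℂ) (mem_closedPoints_iff.mp hyc)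
  exact ⟨P, hyU⟩

/-- **The anchor.** If `A|_{X_{s₀}}` is algebraic, then so is the restriction of `toX^* A` to every
fibre `Y_{(s₀,H)}` of `g` with `H` in an open `U₀ ⊆ (ℙᴺ)^*` all of whose sections `X_{s₀} ∩ H'` are
smooth of dimension `n`: pull `A|_{X_{s₀}}` back FLATLY to the slice family `𝒴_{s₀} ⟶ X_{s₀}`
(`exists_slicePullback_hom_fiberOver`, `map_mem_algebraicClasses_of_flat`), restrict to the smooth
projective family `𝒴_{s₀}|_{U₀} ⟶ U₀` over the quasi-projective smooth irreducible `U₀`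
(`isSmoothProjectiveFamily_snd_openSubschemeOverι`), and restrict to the fibre
(`map_fiberι_mem_algebraicClasses`, the tree's fibre-restriction theorem); the fibres are identified
by `fiberOverFamilyPullbackIso`. [cite: VoisinHodgeII2003, §2.1.1] [cite: Thomas2005Nodes, §5] -/
theorem map_fiberι_toX_mem_algebraicClasses_of_slice (hf : IsSmoothProjectiveFamily f (n + 1))
    [IrreducibleSpace S.left] [SmoothOfRelativeDimension d S.hom] [IsAffine S.left] [IsAffineHom e.left]
    (G : (S ⊗ dualProjectiveSpace N ℂ).left.Opens)
    (hGsm : SmoothOfRelativeDimension n ((CartesianMonoidalCategory.lift (toX N e ≫ f) (proj N e)).left ∣_ G))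
    (hGiff : ∀ b : ComplexPoints (S ⊗ dualProjectiveSpace N ℂ), b.pt ∈ G ↔
      SmoothOfRelativeDimension n (fiberOver (CartesianMonoidalCategory.lift (toX N e ≫ f) (proj N e)) b).hom)
    (hfib : ∀ b : ComplexPoints (S ⊗ dualProjectiveSpace N ℂ), b.pt ∈ G →
      IsSmoothProjective n (fiberOver (CartesianMonoidalCategory.lift (toX N e ≫ f) (proj N e)) b))
    {p : ℕ} {A : complexBetti 𝒳 (2 * p)} (s₀ : ComplexPoints S)
    (hs₀ : complexBetti.map (fiberι f s₀) (2 * p) A ∈ algebraicClasses (fiberOver f s₀) p)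
    (U₀ : (dualProjectiveSpace N ℂ).left.Opens)
    (hU₀ : ∀ H' : ComplexPoints (dualProjectiveSpace N ℂ), H'.pt ∈ U₀ →
      SmoothOfRelativeDimension n
        (fiberOver (CartesianMonoidalCategory.lift (toX N e ≫ f) (proj N e)) (CartesianMonoidalCategory.lift s₀ H')).hom)
    (H : ComplexPoints (dualProjectiveSpace N ℂ)) (hH : H.pt ∈ U₀) :
    complexBetti.map (fiberι (CartesianMonoidalCategory.lift (toX N e ≫ f) (proj N e)) (CartesianMonoidalCategory.lift s₀ H))
        (2 * p) (complexBetti.map (toX N e) (2 * p) A) ∈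
      algebraicClasses (fiberOver (CartesianMonoidalCategory.lift (toX N e ≫ f) (proj N e)) (CartesianMonoidalCategory.lift s₀ H)) p := by
  haveI : Smooth S.hom := SmoothOfRelativeDimension.smooth d _
  haveI : LocallyOfFiniteType S.hom := inferInstance
  haveI : IsSeparated S.hom := inferInstance
  haveI := hGsm
  have hP := isSmoothProjective_projectiveSpace_holds ℂ N
  haveI := hP.smoothOfRelativeDimension
  haveI : Smooth (dualProjectiveSpace N ℂ).hom := SmoothOfRelativeDimension.smooth N _
  haveI : LocallyOfFiniteType (dualProjectiveSpace N ℂ).hom := inferInstance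
  haveI : IrreducibleSpace (dualProjectiveSpace N ℂ).left := hP.irreducibleSpace
  set g := CartesianMonoidalCategory.lift (toX N e ≫ f) (proj N e) with hg
  set σ : dualProjectiveSpace N ℂ ⟶ S ⊗ dualProjectiveSpace N ℂ :=
    CartesianMonoidalCategory.lift (toSpecOver (dualProjectiveSpace N ℂ) ≫ s₀) (𝟙 (dualProjectiveSpace N ℂ)) with hσ
  set π₀ := familyPullback.snd g σ with hπ₀
  haveI : IsProper g.left := isProper_sectionFamily_left f e hf
  haveI : IsProper π₀.left := by
    change IsProper (pullback.snd g.left σ.left)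
    infer_instance
  -- `π₀` is smooth over `U₀ ⊆ σ⁻¹ G`, with smooth projective fibres there
  have hUG : U₀ ≤ σ.left ⁻¹ᵁ G := fun x hx =>
    preimage_le_preimage_goodLocus f e s₀ (𝟙 (dualProjectiveSpace N ℂ)) U₀ hU₀ G hGiff hx
  have hsm₀ : SmoothOfRelativeDimension n (π₀.left ∣_ U₀) :=
    smoothOfRelativeDimension_snd_morphismRestrict (n := n) f e σ G U₀ hUG
  have hσG : ∀ H' : ComplexPoints (dualProjectiveSpace N ℂ), H'.pt ∈ U₀ → (AlgPoints.map σ H').pt ∈ G := by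
    intro H' hH'
    rw [hGiff, map_slice]
    exact hU₀ H' hH'
  have hfib₀ : ∀ H' : ComplexPoints (dualProjectiveSpace N ℂ), H'.pt ∈ U₀ → IsSmoothProjective n (fiberOver π₀ H') :=
    fun H' hH' => (hfib _ (hσG H' hH')).of_iso (fiberOverFamilyPullbackIso g σ H').symm
  have hF₀ := isSmoothProjectiveFamily_snd_openSubschemeOverι π₀ U₀ hsm₀ hfib₀
  -- the base `U₀`: quasi-projective, irreducible, smooth
  haveI : IsOpenImmersion (openSubschemeOverι (dualProjectiveSpace N ℂ) U₀).left :=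
    inferInstanceAs (IsOpenImmersion U₀.ι)
  have hWq : IsQuasiProjectiveOver (openSubschemeOver (dualProjectiveSpace N ℂ) U₀) :=
    ⟨dualProjectiveSpace N ℂ, openSubschemeOverι _ U₀, hP.isProjectiveOver, inferInstance⟩
  haveI : IrreducibleSpace (openSubschemeOver (dualProjectiveSpace N ℂ) U₀).left := by
    change IrreducibleSpace U₀
    exact isIrreducible_iff_irreducibleSpace.mp ⟨⟨H.pt, hH⟩,
      (PreirreducibleSpace.isPreirreducible_univ (X := (dualProjectiveSpace N ℂ).left)).open_subset U₀.isOpen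
        (Set.subset_univ _)⟩
  haveI : Smooth (openSubschemeOver (dualProjectiveSpace N ℂ) U₀).hom := by
    change Smooth (U₀.ι ≫ (dualProjectiveSpace N ℂ).hom)
    infer_instance
  -- the flat map to `X_{s₀}` and the algebraic total class
  obtain ⟨v, hv, hvflat⟩ := exists_slicePullback_hom_fiberOver f e s₀ hf
  haveI := hvflat
  haveI : IsOpenImmersion (familyPullback.fst π₀ (openSubschemeOverι (dualProjectiveSpace N ℂ) U₀)).left :=
    MorphismProperty.of_isPullback (P := @IsOpenImmersion)
      ((familyPullback.isPullback π₀ (openSubschemeOverι _ U₀)).map (Over.forget _)).flip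
      ‹IsOpenImmersion (openSubschemeOverι (dualProjectiveSpace N ℂ) U₀).left›
  haveI : Flat (familyPullback.fst π₀ (openSubschemeOverι (dualProjectiveSpace N ℂ) U₀) ≫ v).left := by
    rw [Over.comp_left]; infer_instance
  haveI : IsLocallyNoetherian (fiberOver f s₀).left :=
    IsSmoothProjective.isLocallyNoetherian_holds (hf.isSmoothProjective s₀)
  haveI : IsLocallyNoetherian (familyPullback π₀ (openSubschemeOverι (dualProjectiveSpace N ℂ) U₀)).left := by
    haveI := locallyOfFiniteType_total_hom f hf
    haveI := locallyOfFiniteType_section_hom e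
    haveI : LocallyOfFiniteType (familyPullback g σ).hom := by
      rw [familyPullback_hom]
      haveI : LocallyOfFiniteType σ.left := by
        have h : LocallyOfFiniteType (σ.left ≫ (S ⊗ dualProjectiveSpace N ℂ).hom) := by rw [Over.w]; infer_instance
        exact locallyOfFiniteType_of_comp σ.left (S ⊗ dualProjectiveSpace N ℂ).hom
      have h1 : LocallyOfFiniteType (pullback.fst g.left σ.left) :=
        MorphismProperty.pullback_fst (P := @LocallyOfFiniteType) _ _ inferInstance
      exact MorphismProperty.comp_mem @LocallyOfFiniteType _ _ h1 ‹LocallyOfFiniteType (universalHyperplaneSection N e).hom›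
    haveI : LocallyOfFiniteType (familyPullback π₀ (openSubschemeOverι (dualProjectiveSpace N ℂ) U₀)).hom := by
      rw [familyPullback_hom]
      have h1 : LocallyOfFiniteType (pullback.fst π₀.left (openSubschemeOverι (dualProjectiveSpace N ℂ) U₀).left) :=
        MorphismProperty.pullback_fst (P := @LocallyOfFiniteType) _ _ inferInstance
      exact MorphismProperty.comp_mem @LocallyOfFiniteType _ _ h1 ‹LocallyOfFiniteType (familyPullback g σ).hom›
    exact LocallyOfFiniteType.isLocallyNoetherian (familyPullback π₀ (openSubschemeOverι _ U₀)).hom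
  have hB₀ := map_mem_algebraicClasses_of_flat
    (familyPullback.fst π₀ (openSubschemeOverι (dualProjectiveSpace N ℂ) U₀) ≫ v) hs₀
  -- the complex point `u₀` of `U₀` under `H`
  have hrange : Set.range (AlgPoints.map (L := ℂ) (openSubschemeOverι (dualProjectiveSpace N ℂ) U₀)) =
      {P | P.pt ∈ U₀} := by
    rw [AlgPoints.range_map_of_isOpenImmersion_holds]
    ext P
    change P.pt ∈ U₀.ι.opensRange ↔ P.pt ∈ U₀
    rw [Scheme.Opens.opensRange_ι]
  obtain ⟨u₀, hu₀⟩ : H ∈ Set.range (AlgPoints.map (L := ℂ) (openSubschemeOverι (dualProjectiveSpace N ℂ) U₀)) := by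
    rw [hrange]; exact hH
  have halg := map_fiberι_mem_algebraicClasses _ hF₀ hWq hB₀ u₀
  -- identify the fibre over `u₀` with `Y_{(s₀,H)}` and the classes
  subst hu₀
  rw [← map_slice s₀]
  set ψ := fiberOverFamilyPullbackIso π₀ (openSubschemeOverι (dualProjectiveSpace N ℂ) U₀) u₀ ≪≫
    fiberOverFamilyPullbackIso g σ (AlgPoints.map (openSubschemeOverι (dualProjectiveSpace N ℂ) U₀) u₀) with hψ
  rw [← mem_algebraicClasses_map_iff_of_iso ψ]
  convert halg using 1
  rw [← CategoryTheory.comp_apply, ← complexBetti.map_comp, ← CategoryTheory.comp_apply, ← complexBetti.map_comp,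
    ← CategoryTheory.comp_apply, ← complexBetti.map_comp, ← CategoryTheory.comp_apply, ← complexBetti.map_comp]
  congr 1
  rw [hψ, Iso.trans_hom, Category.assoc, Category.assoc, Category.assoc,
    ← Category.assoc (fiberOverFamilyPullbackIso g σ _).hom, fiberOverFamilyPullbackIso_hom_fiberι,
    Category.assoc, ← hv, ← Category.assoc, ← Category.assoc, fiberOverFamilyPullbackIso_hom_fiberι,
    Category.assoc, Category.assoc]
  simp only [Category.assoc]

end ThomasFamily

end Literature.AlgebraicGeometry.HodgeTheory.SectionFamily

end
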